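import Summits.BirchSwinnertonDyer.BirchSwinnertonDyer.Theorems.ByReductionTypeAtTwoRankOneAtTwoBigImageOddLocalFklLevelShift
import HarnessLib

/-!
# Line `fkl` of crux `RankOneAtTwoBigImageOddLocal` (stmt-BirchSwinnertonDyer-23715, route ByReductionTypeAtTwo):
# `ψ`-INDEPENDENCE — at a fixed `(ℓ, k)` all surjective discrete logarithms give the same K2-F row

Lead prover seat `bsd-line-fkl-p1` (g2), helpers `--supports stmt-BirchSwinnertonDyer-23715` (v7 stubs (2a)/(2b)/(3a)/(3b) quantify over
EVERY surjective `ψ : (ℤ/ℓ)ˣ → ℤ/2^k`; this file shows one `ψ` per `(ℓ, k)` suffices).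

Two surjective `ψ₁, ψ₂ : (ℤ/ℓ)ˣ → ℤ/2^k` (`ℓ` prime, `k ≥ 1`) differ by an odd multiplier: `ψ₂ = a·ψ₁` with `a ∈ (ℤ/2^k)ˣ`
(`exists_odd_mul_of_surjective`: the unit group is cyclic, a surjective `ψ` sends a generator to an additive generator = a unit of the
ring `ℤ/2^k`).  The canonical lifts then satisfy `ψ̃₂(u) ≡ ã·ψ̃₁(u) (mod 2^k)`, so for the newform `f` of a curve of positive analytic
rank (`2[u/ℓ]⁺_f ∈ ℤ`): `δ'_k(ℓ; ψ₂) − ã·δ'_k(ℓ; ψ₁) ∈ 2^k ℤ_{(2)}` (`levelSumTwo_sub_mul_inTwoPowZLoc`) and, `ã` being odd,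
`δ'_k(ℓ; ψ₂) ∈ 2^m ℤ_{(2)} ⟺ δ'_k(ℓ; ψ₁) ∈ 2^m ℤ_{(2)}` for every `m ≤ k` (`inTwoPowZLoc_levelSumTwo_iff_of_surjective`).
Consequence for the stubs: in (HC)/(NV) the quantifier «∀/∃ surjective `ψ`» at a row `(ℓ, k)` may be replaced by ANY ONE surjective `ψ`
(`firstLayer_row_forall_iff_exists`).  Theorems only; no `def`, no named-fact hypothesis, no `sorry`.  BSD is not proved by any of this.
-/

set_option autoImplicit false

noncomputable section

open scoped Classical MatrixGroups ModularForm

set_option linter.dupNamespace false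

namespace Summit.BirchSwinnertonDyer.BirchSwinnertonDyer.Theorems.RankOneAtTwoFkl

open CongruenceSubgroup WeierstrassCurve Literature.NumberTheory.EllipticCurves
  Literature.NumberTheory.EllipticCurves.ModularForms Summit.BirchSwinnertonDyer.Rank1Residual.F1Sign2

/-! ## Two surjective level characters differ by a unit -/

/-- **Surjective level characters differ by an odd multiplier.**  For a prime `ℓ`, `k ≥ 1` and two SURJECTIVE homomorphisms
`ψ₁, ψ₂ : (ℤ/ℓ)ˣ → ℤ/2^k` there is `a ∈ ℤ/2^k` with `a.val` odd and `ψ₂(u) = a·ψ₁(u)` for all `u`. [folklore] -/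
theorem exists_odd_mul_of_surjective {ℓ : ℕ} [Fact ℓ.Prime] {k : ℕ} (hk : 1 ≤ k)
    (ψ₁ ψ₂ : (ZMod ℓ)ˣ →* Multiplicative (ZMod (2 ^ k))) (h₁ : Function.Surjective ψ₁)
    (h₂ : Function.Surjective ψ₂) :
    ∃ a : ZMod (2 ^ k), Odd a.val ∧ ∀ u, Multiplicative.toAdd (ψ₂ u) = a * Multiplicative.toAdd (ψ₁ u) := by
  haveI : NeZero (2 ^ k) := ⟨by positivity⟩
  obtain ⟨g, hg⟩ := IsCyclic.exists_generator (α := (ZMod ℓ)ˣ)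
  have hgen : ∀ x : (ZMod ℓ)ˣ, ∃ n : ℕ, g ^ n = x := fun x =>
    (Submonoid.mem_powers_iff _ _).mp (mem_powers_iff_mem_zpowers.mpr (hg x))
  set x₁ := Multiplicative.toAdd (ψ₁ g) with hx₁
  set x₂ := Multiplicative.toAdd (ψ₂ g) with hx₂
  have hpow : ∀ (ψ : (ZMod ℓ)ˣ →* Multiplicative (ZMod (2 ^ k))) (n : ℕ),
      Multiplicative.toAdd (ψ (g ^ n)) = (n : ZMod (2 ^ k)) * Multiplicative.toAdd (ψ g) := by
    intro ψ n
    rw [map_pow, toAdd_pow, nsmul_eq_mul]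
  -- inverses of `x₁`, `x₂` from surjectivity
  have hinv : ∀ (ψ : (ZMod ℓ)ˣ →* Multiplicative (ZMod (2 ^ k))), Function.Surjective ψ →
      ∃ n : ZMod (2 ^ k), n * Multiplicative.toAdd (ψ g) = 1 := by
    intro ψ hψ
    obtain ⟨u, hu⟩ := hψ (Multiplicative.ofAdd 1)
    obtain ⟨n, rfl⟩ := hgen u
    refine ⟨n, ?_⟩
    rw [← hpow ψ n, hu, toAdd_ofAdd]
  obtain ⟨n₁, hn₁⟩ := hinv ψ₁ h₁
  obtain ⟨n₂, hn₂⟩ := hinv ψ₂ h₂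
  refine ⟨x₂ * n₁, ?_, ?_⟩
  · -- `a = x₂ n₁` is a unit: `a · (x₁ n₂) = 1`
    have hunit : IsUnit (x₂ * n₁) := by
      refine IsUnit.of_mul_eq_one (x₁ * n₂) ?_
      calc x₂ * n₁ * (x₁ * n₂) = (n₁ * x₁) * (n₂ * x₂) := by ring
        _ = 1 := by rw [hn₁, hn₂, one_mul]
    have hcop : Nat.Coprime (x₂ * n₁).val (2 ^ k) := by
      obtain ⟨w, hw⟩ := hunit
      rw [← hw]
      exact ZMod.val_coe_unit_coprime w
    have h2 : Nat.Coprime (x₂ * n₁).val 2 := (Nat.coprime_pow_right_iff hk _ _).mp hcop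
    exact Nat.coprime_two_right.mp h2
  · intro u
    obtain ⟨n, rfl⟩ := hgen u
    rw [hpow ψ₂ n, hpow ψ₁ n]
    calc (n : ZMod (2 ^ k)) * x₂ = (n : ZMod (2 ^ k)) * x₂ * (n₁ * x₁) := by rw [hn₁, mul_one]
      _ = x₂ * n₁ * ((n : ZMod (2 ^ k)) * x₁) := by ring

/-! ## Odd multipliers do not move `2^m ℤ_{(2)}` -/

/-- For an odd natural number `a`: `a·x ∈ 2^m ℤ_{(2)} ⟺ x ∈ 2^m ℤ_{(2)}`. [folklore] -/
theorem inTwoPowZLoc_odd_mul_iff {a : ℕ} (ha : Odd a) (m : ℕ) (x : ℚ) :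
    InTwoPowZLoc m ((a : ℚ) * x) ↔ InTwoPowZLoc m x := by
  have ha0 : (a : ℚ) ≠ 0 := by
    have : a ≠ 0 := fun h => by rw [h] at ha; exact (Nat.not_odd_zero ha).elim
    exact_mod_cast this
  have ha0' : a ≠ 0 := fun h => by rw [h] at ha; exact (Nat.not_odd_zero ha).elim
  constructor
  · rintro ⟨q, hq, hd⟩
    refine ⟨q / a, ?_, ?_⟩
    · rw [← mul_div_assoc, ← hq, mul_div_cancel_left₀ x ha0]
    · have h1 : (q / (a : ℚ)).den ∣ q.den * a := by
        have h := Rat.mul_den_dvd q ((a : ℚ)⁻¹)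
        rw [Rat.inv_natCast_den, if_neg ha0'] at h
        rwa [div_eq_mul_inv]
      exact (Nat.odd_mul.mpr ⟨hd, ha⟩).of_dvd_nat h1
  · rintro ⟨q, hq, hd⟩
    refine ⟨(a : ℚ) * q, by rw [hq]; ring, ?_⟩
    have h1 : ((a : ℚ) * q).den ∣ (a : ℚ).den * q.den := Rat.mul_den_dvd _ _
    rw [Rat.den_natCast, one_mul] at h1
    exact hd.of_dvd_nat h1

/-! ## `ψ`-independence of the K2-F rows -/

/-- **`δ'_k(ℓ; ψ₂) − ã·δ'_k(ℓ; ψ₁) ∈ 2^k ℤ_{(2)}`** for two surjective `ψ₁, ψ₂` with `ψ₂ = a·ψ₁`, `ã = a.val`, and the newform `f` of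
a globally minimal curve of positive analytic rank (`2[u/ℓ]⁺_f ∈ ℤ`): the lifts satisfy `ψ̃₂(u) = ã ψ̃₁(u) − 2^k ⌊ã ψ̃₁(u)/2^k⌋`.
[folklore] -/
theorem levelSumTwo_sub_mul_inTwoPowZLoc (W : WeierstrassCurve ℚ) [W.IsElliptic] [W.IsGloballyMinimal]
    {M : ℕ} [NeZero M] (f : CuspForm (Gamma0 M) 2) (hf : IsNewformOf W f) (hr : W.analyticRank ≠ 0)
    {ℓ : ℕ} [Fact ℓ.Prime] (hN : ¬ ℓ ∣ W.conductorNorm ℤ) {k : ℕ}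
    (ψ₁ ψ₂ : (ZMod ℓ)ˣ →* Multiplicative (ZMod (2 ^ k))) (a : ZMod (2 ^ k))
    (ha : ∀ u, Multiplicative.toAdd (ψ₂ u) = a * Multiplicative.toAdd (ψ₁ u)) :
    InTwoPowZLoc k (levelSumTwo f ℓ k ψ₂ - (a.val : ℚ) * levelSumTwo f ℓ k ψ₁) := by
  have hℓ : ℓ.Prime := Fact.out
  haveI : NeZero ℓ := ⟨hℓ.ne_zero⟩
  haveI : NeZero (2 ^ k) := ⟨by positivity⟩
  have hℓM : ¬ ℓ ∣ M := fun h => hN ((hf.dvd_level_iff_dvd_conductorNorm hℓ).mp h)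
  have hcop : Nat.Coprime ℓ M := (Nat.Prime.coprime_iff_not_dvd hℓ).mpr hℓM
  have hden : ∀ u : (ZMod ℓ)ˣ, Nat.Coprime ((((u : ZMod ℓ).val : ℚ)) / ℓ).den M := fun u => by
    have h := coprime_den_of_coprime (N := M) hcop ((u : ZMod ℓ).val : ℤ)
    rwa [Int.cast_natCast] at h
  choose kk hkk using fun u : (ZMod ℓ)ˣ =>
    exists_ratPlusSymbol_eq_int_div_two W f hf hr (hden u)
  set b : (ZMod ℓ)ˣ → ℕ := fun u => (Multiplicative.toAdd (ψ₁ u)).val with hb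
  -- `ψ̃₂(u) = (ã ψ̃₁(u)) % 2^k`
  have hval : ∀ u, (Multiplicative.toAdd (ψ₂ u)).val = (a.val * b u) % 2 ^ k := by
    intro u
    rw [ha u, ZMod.val_mul]
  -- integer weight and the difference
  let g : (ZMod ℓ)ˣ → ℤ := fun u => kk u * ((a.val * b u / 2 ^ k : ℕ) : ℤ)
  have hdiff : levelSumTwo f ℓ k ψ₂ - (a.val : ℚ) * levelSumTwo f ℓ k ψ₁ =
      -(2 ^ k * ∑ u : (ZMod ℓ)ˣ, (g u : ℚ)) := by
    unfold levelSumTwo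
    rw [Finset.mul_sum, Finset.mul_sum, ← Finset.sum_sub_distrib, ← Finset.sum_neg_distrib]
    refine Finset.sum_congr rfl fun u _ => ?_
    have hPq : ((2 ^ k : ℕ) : ℚ) = 2 ^ k := by norm_num
    have hd : (((a.val * b u) % 2 ^ k : ℕ) : ℚ) =
        ((a.val * b u : ℕ) : ℚ) - ((2 ^ k : ℕ) : ℚ) * ((a.val * b u / 2 ^ k : ℕ) : ℚ) := by
      have h := Nat.mod_add_div (a.val * b u) (2 ^ k)
      have h' : ((((a.val * b u) % 2 ^ k + 2 ^ k * (a.val * b u / 2 ^ k) : ℕ)) : ℚ) = ((a.val * b u : ℕ) : ℚ) := by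
        exact_mod_cast h
      push_cast at h' ⊢
      linarith
    have h2 : 2 * ratPlusSymbol f ((((u : ZMod ℓ).val : ℚ)) / ℓ) = kk u := by rw [hkk u]; ring
    have hg' : ((g u : ℤ) : ℚ) = (kk u : ℚ) * ((a.val * b u / 2 ^ k : ℕ) : ℚ) := by
      simp only [g, Int.cast_mul, Int.cast_natCast]
    show 2 * ratPlusSymbol f ((((u : ZMod ℓ).val : ℚ)) / ℓ) * (((Multiplicative.toAdd (ψ₂ u)).val : ℕ) : ℚ) -
        (a.val : ℚ) * (2 * ratPlusSymbol f ((((u : ZMod ℓ).val : ℚ)) / ℓ) * ((b u : ℕ) : ℚ)) =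
      -(2 ^ k * ((g u : ℤ) : ℚ))
    rw [hval u, hd, h2, hg', hPq]
    push_cast
    ring
  refine ⟨-((∑ u : (ZMod ℓ)ˣ, g u : ℤ) : ℚ), ?_, by rw [Rat.neg_den, Rat.den_intCast]; exact odd_one⟩
  rw [hdiff]
  push_cast
  ring

/-- **`ψ`-INDEPENDENCE of the K2-F rows.**  For the newform `f` of a globally minimal `W/ℚ` of positive analytic rank, an odd prime
`ℓ ∤ N_W`, `k ≥ 1`, two SURJECTIVE `ψ₁, ψ₂ : (ℤ/ℓ)ˣ → ℤ/2^k` and every `m ≤ k`: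
`δ'_k(ℓ; ψ₁) ∈ 2^m ℤ_{(2)} ⟺ δ'_k(ℓ; ψ₂) ∈ 2^m ℤ_{(2)}`. [folklore] -/
theorem inTwoPowZLoc_levelSumTwo_iff_of_surjective (W : WeierstrassCurve ℚ) [W.IsElliptic] [W.IsGloballyMinimal]
    {M : ℕ} [NeZero M] (f : CuspForm (Gamma0 M) 2) (hf : IsNewformOf W f) (hr : W.analyticRank ≠ 0)
    {ℓ : ℕ} [Fact ℓ.Prime] (hN : ¬ ℓ ∣ W.conductorNorm ℤ) {k : ℕ} (hk : 1 ≤ k)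
    (ψ₁ ψ₂ : (ZMod ℓ)ˣ →* Multiplicative (ZMod (2 ^ k))) (h₁ : Function.Surjective ψ₁)
    (h₂ : Function.Surjective ψ₂) {m : ℕ} (hm : m ≤ k) :
    InTwoPowZLoc m (levelSumTwo f ℓ k ψ₁) ↔ InTwoPowZLoc m (levelSumTwo f ℓ k ψ₂) := by
  obtain ⟨a, hodd, ha⟩ := exists_odd_mul_of_surjective hk ψ₁ ψ₂ h₁ h₂
  have hsub := levelSumTwo_sub_mul_inTwoPowZLoc W f hf hr hN ψ₁ ψ₂ a ha
  rw [(inTwoPowZLoc_iff_of_sub hm hsub : InTwoPowZLoc m (levelSumTwo f ℓ k ψ₂) ↔ _),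
    inTwoPowZLoc_odd_mul_iff hodd]

/-- **One `ψ` per row suffices.**  In positive analytic rank, at a row `(ℓ, k)` (`ℓ ∤ N_W` odd prime, `k ≥ 1`) and for `m ≤ k`:
«EVERY surjective `ψ` has `δ'_k(ℓ;ψ) ∈ 2^m ℤ_{(2)}`» ⟺ «SOME surjective `ψ` has it» — provided a surjective `ψ` exists
(`2^k ∣ ℓ − 1`, `…FklTopLevel.exists_surjective_levelChar`). [folklore] -/
theorem firstLayer_row_forall_iff_exists (W : WeierstrassCurve ℚ) [W.IsElliptic] [W.IsGloballyMinimal]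
    {M : ℕ} [NeZero M] (f : CuspForm (Gamma0 M) 2) (hf : IsNewformOf W f) (hr : W.analyticRank ≠ 0)
    {ℓ : ℕ} [Fact ℓ.Prime] (hN : ¬ ℓ ∣ W.conductorNorm ℤ) {k : ℕ} (hk : 1 ≤ k) (hℓk : 2 ^ k ∣ ℓ - 1)
    {m : ℕ} (hm : m ≤ k) :
    (∀ ψ : (ZMod ℓ)ˣ →* Multiplicative (ZMod (2 ^ k)), Function.Surjective ψ →
        InTwoPowZLoc m (levelSumTwo f ℓ k ψ)) ↔
      ∃ ψ : (ZMod ℓ)ˣ →* Multiplicative (ZMod (2 ^ k)), Function.Surjective ψ ∧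
        InTwoPowZLoc m (levelSumTwo f ℓ k ψ) := by
  obtain ⟨ψ₀, hψ₀⟩ := exists_surjective_levelChar (ℓ := ℓ) hℓk
  constructor
  · intro h
    exact ⟨ψ₀, hψ₀, h ψ₀ hψ₀⟩
  · rintro ⟨ψ, hψ, hx⟩ ψ' hψ'
    exact (inTwoPowZLoc_levelSumTwo_iff_of_surjective W f hf hr hN hk ψ ψ' hψ hψ' hm).mp hx

end Summit.BirchSwinnertonDyer.BirchSwinnertonDyer.Theorems.RankOneAtTwoFkl

end
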